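import Mathlib
import Literature.Analysis.Fourier.BandlimitedSupBound
import Summits.NavierStokesRegularity.NavierStokesRegularity.Theorems.FilamentSkeletonRssClause13LowSliceForm

/-!
# Clause 13-J, brick B8: BERNSTEIN PER FREQUENCY SLICE in the model units of B2–B4
# `‖f‖_∞² ≤ (k₀/π)·‖f‖₂²` when the un-normalised transform `F(z) = ∫ f(x)e^{izx}dx` vanishes for `|z| > k₀`

Route `FilamentSkeletonRss`, child `Clause13NearStraightL` (stmt-NavierStokesRegularity-23321; typing-agnostic, valid verbatim for the A1G
twin 28296); design of record `filament-plan/DESIGN-NOTE-28296-tenure-g22.md` §5 ("L² → L∞ (the clause is L∞-typed): Bernstein per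
frequency slice, no L∞ commutator theory … ‖Y_j‖_∞ ≤ √(k_j/π)‖Y_j‖₂").  The Literature lemma
`Literature.Analysis.Fourier.norm_sq_le_two_mul_integral_of_fourier_support` (Bernstein–Nikol'skii, Mathlib's convention `𝓕f(ξ)`,
support `|ξ| ≤ K`) is transported to the bricks' un-normalised variable `z = −2πξ` (`unnormalisedTransform_eq_fourier`, p669628):
support `|z| ≤ k₀` ⇔ `|ξ| ≤ k₀/(2π)`, constant `2K = k₀/π`.  Combined with the low-slice gain (`modelSelfForm_re_le_of_lowSlice`) this is
the per-slice `L∞` control of the note's §5 for the model self operator.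
Lane ns-filament-19175-p1 g14; `--supports stmt-NavierStokesRegularity-23321 --as helper`.
HONEST FRAMING: harmonic analysis attached to a HYPOTHETICAL filament skeleton on the NEGATIVE side of a MODEL route; nothing here bears
on Navier–Stokes regularity or blow-up.
-/

noncomputable section

open MeasureTheory Real Complex Filter Set
open scoped FourierTransform ComplexConjugate

namespace Summit.NavierStokesRegularity.NavierStokesRegularity.Theorems.MatchedKernel
set_option linter.dupNamespace false

/-- Support transport: if `F(z) = ∫ f(x)e^{izx}dx` vanishes for `|z| > k₀` then `𝓕 f(ξ) = 0` for `|ξ| > k₀/(2π)`. [folklore] -/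
theorem fourier_eq_zero_of_unnormalisedTransform_support {f : ℝ → ℂ} {k₀ : ℝ}
    (hsupp : ∀ z : ℝ, k₀ < |z| → ∫ x : ℝ, f x * cexp (I * z * x) = 0) (ξ : ℝ) (hξ : k₀ / (2 * π) < |ξ|) :
    𝓕 f ξ = 0 := by
  have h := unnormalisedTransform_eq_fourier f (-(2 * π * ξ))
  rw [show -(-(2 * π * ξ)) / (2 * π) = ξ by field_simp] at h
  rw [← h]
  refine hsupp _ ?_
  rw [abs_neg, abs_mul, abs_of_pos (by positivity : (0 : ℝ) < 2 * π)]
  rwa [div_lt_iff₀ (by positivity : (0 : ℝ) < 2 * π), mul_comm] at hξ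

/-- **BERNSTEIN PER SLICE (model units).**  For `f ∈ L¹ ∩ L²(ℝ; ℂ)` continuous whose un-normalised transform
`F(z) = ∫ f(x)e^{izx}dx` vanishes for `|z| > k₀` (`k₀ ≥ 0`): `‖f x‖² ≤ (k₀/π)·∫‖f‖²` for every `x`. [folklore] -/
theorem norm_sq_le_of_unnormalisedTransform_support {f : ℝ → ℂ} (hf : Integrable f) (hf2 : MemLp f 2) (hfc : Continuous f)
    {k₀ : ℝ} (hk : 0 ≤ k₀) (hsupp : ∀ z : ℝ, k₀ < |z| → ∫ x : ℝ, f x * cexp (I * z * x) = 0) (x : ℝ) :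
    ‖f x‖ ^ 2 ≤ k₀ / π * ∫ t : ℝ, ‖f t‖ ^ 2 := by
  have hK : 0 ≤ k₀ / (2 * π) := by positivity
  have h := Literature.Analysis.Fourier.norm_sq_le_two_mul_integral_of_fourier_support hf hf2 hfc hK
    (fourier_eq_zero_of_unnormalisedTransform_support hsupp) x
  calc ‖f x‖ ^ 2 ≤ 2 * (k₀ / (2 * π)) * ∫ t : ℝ, ‖f t‖ ^ 2 := h
    _ = k₀ / π * ∫ t : ℝ, ‖f t‖ ^ 2 := by congr 1; field_simp

/-- The same with the sup-type constant `√(k₀/π)`: `‖f x‖ ≤ √(k₀/π)·√(∫‖f‖²)`. [folklore] -/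
theorem norm_le_of_unnormalisedTransform_support {f : ℝ → ℂ} (hf : Integrable f) (hf2 : MemLp f 2) (hfc : Continuous f)
    {k₀ : ℝ} (hk : 0 ≤ k₀) (hsupp : ∀ z : ℝ, k₀ < |z| → ∫ x : ℝ, f x * cexp (I * z * x) = 0) (x : ℝ) :
    ‖f x‖ ≤ Real.sqrt (k₀ / π) * Real.sqrt (∫ t : ℝ, ‖f t‖ ^ 2) := by
  have h := norm_sq_le_of_unnormalisedTransform_support hf hf2 hfc hk hsupp x
  have hI : 0 ≤ ∫ t : ℝ, ‖f t‖ ^ 2 := integral_nonneg fun _ => by positivity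
  rw [← Real.sqrt_mul (by positivity : 0 ≤ k₀ / π)]
  calc ‖f x‖ = Real.sqrt (‖f x‖ ^ 2) := (Real.sqrt_sq (norm_nonneg _)).symm
    _ ≤ Real.sqrt (k₀ / π * ∫ t : ℝ, ‖f t‖ ^ 2) := Real.sqrt_le_sqrt h

/-- **PER-SLICE `L∞` CONTROL OF THE LOW SLICE (note §5, model units).**  If `F` vanishes off the slice `a ≤ |z|√q ≤ 1/10` then BOTH
the low-slice gain `−Re(model self form) ≥ (2/q)(a²/4)log(1/a)·∫‖f‖²` AND the Bernstein bound `‖f x‖² ≤ (1/(10π√q))·∫‖f‖²` hold —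
so `‖f‖_∞² ≤ (1/(10π√q)) · (−Re form) / ((2/q)(a²/4)log(1/a))` whenever the gain is positive (`a < 1`). [folklore] -/
theorem lowSlice_gain_and_bernstein {q a : ℝ} (hq : 0 < q) (ha : 0 < a) {f : ℝ → ℂ}
    (hf : Integrable f) (hf2 : MemLp f 2) (hfc : Continuous f)
    (hsupp : ∀ z : ℝ, (|z| * √q < a ∨ 1 / 10 < |z| * √q) → ∫ x : ℝ, f x * cexp (I * z * x) = 0) (x : ℝ) :
    ((2 / q : ℂ) * (∫ t : ℝ, conj (f t) * f t)
      - ∫ t : ℝ, ∫ u : ℝ, ((((2 * q - (t - u) ^ 2) * (((t - u) ^ 2 + q) ^ (5 / 2 : ℝ))⁻¹ : ℝ)) : ℂ) * f u * conj (f t)).re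
      ≤ -(2 / q * (a ^ 2 / 4) * Real.log (1 / a)) * ∫ t : ℝ, ‖f t‖ ^ 2
    ∧ ‖f x‖ ^ 2 ≤ (1 / 10 / √q) / π * ∫ t : ℝ, ‖f t‖ ^ 2 := by
  refine ⟨modelSelfForm_re_le_of_lowSlice hq ha hf hf2 hsupp, ?_⟩
  have hsq : 0 < √q := Real.sqrt_pos.2 hq
  refine norm_sq_le_of_unnormalisedTransform_support hf hf2 hfc (by positivity) (fun z hz => hsupp z (Or.inr ?_)) x
  rwa [div_lt_iff₀ hsq] at hz

end Summit.NavierStokesRegularity.NavierStokesRegularity.Theorems.MatchedKernel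

end
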